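import Literature.AlgebraicGeometry.Frobenioids.DivisorMonoidCategoryTheoreticityCor411iiiCompatHolds
import HarnessLib

/-!
# Frobenioids I, Corollary 4.11 (iii), compatibility clause `PreFrobenioidData.Cor411iii_compat`
# HEAD-MATCHED AT THE DATA OF RECORD (FACT-LIST row F-1028) — PROOF-ONLY

Mochizuki, *The geometry of Frobenioids I: the general theory*, Kyushu J. Math. **62** (2008) 293–400,
Cor. 4.11 (iii) p. 92: "there exists an isomorphism of functors `Ψ^Φ : Φ₁ ⥲ Φ₂` [where we regard, for `i = 1, 2`,
the functor `Φ_i : D_i → Mon` as a functor on `D_i`] lying over the equivalence of categories `Ψ^Base` of (i), which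
is compatible [when the `C_i` are of isotropic, but not of group-like type] with the isomorphism `Ψ^Prime` of
Theorem 4.2, (ii)" [cite: MochizukiFrdI2008, Cor. 4.11 (iii) p.92] (quoted verbatim, brackets print's own; print's
cross-reference "of (i)" points at the equivalence `Ψ^Base : D₁ ⥲ D₂`, which the corollary introduces in its item (ii),
p. 91: "There exists a 1-unique functor `Ψ^Base : D₁ → D₂` that fits into a 1-commutative diagram" — the `Ψ^Base` of
Cor. 4.11 (ii) below).  Doc-only v2 of this file (module header only; the declaration is unchanged).

PROOF-ONLY companion (cell abc-iut, block F, seat abc-iut-f-020, KEY INST59A; FROZEN FACT-LIST row F-1028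
`PreFrobenioidData.Cor411iii_compat`; 0 `def`, 0 `instance`, 0 `structure`; nothing restated).  The typed clause is a
SCHEMA over free data `(Ψ^Φ' = E, e)`; its universal closure is false (`not_forall_cor411iii_compat`,
`DivisorMonoidCategoryTheoreticityCor411ivSchemaNegative.lean`: a mismatched pair violates it) and the instance of
record — seat abc-iut-f-033's `PreFrobenioid.cor411iii_compat_holds_of_isOfFSMType` — is an ∃-PACKAGE
(`∃ e E Ψ^Base η E' e', … ∧ Cor411iii_compat E' e'`), so no theorem of the tree has the schema as its conclusion
HEAD.  This file names the packaged data by `Exists.choose` and states the schema FOR THEM, every remaining binder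
universally quantified: for Frobenioids `C_i → F_{Φ_i}` with `Φ_i` perf-factorial over bases of FSM-type, of isotropic
and non-group-like type, `C₁` of rationally standard type at ITS Def. 4.5 (iii) parameters, and an equivalence
`Ψ : C₁ ⥲ C₂` in the setting of Cor. 4.11, the typed `Cor411iii_compat` HOLDS at THE descended `Ψ^Φ'` over THE
`Ψ^Base` of Cor. 4.11 (ii) and THE bijections of primes `e'` induced by THE `Ψ^Prime` of Thm. 4.2 (ii).

Classical, undisputed mathematics ([FrdI] is a refereed prerequisite); OUR kernel check of OUR typed slot; nothing
here bears on [IUTchIII] Cor. 3.12 or asserts anything about abc; typed ≠ proved for anything not in this file.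
-/

namespace Literature.AlgebraicGeometry.Frobenioids

open CategoryTheory Opposite

universe w v v' u u'

namespace PreFrobenioid

variable {D₁ : Type u} [Category.{v} D₁] {Φ₁ : D₁ᵒᵖ ⥤ CommMonCat.{w}} {C₁ : Type u'} [Category.{v'} C₁]
  {D₂ : Type u} [Category.{v} D₂] {Φ₂ : D₂ᵒᵖ ⥤ CommMonCat.{w}} {C₂ : Type u'} [Category.{v'} C₂]
  {F₁ : C₁ ⥤ ElemFrobenioid Φ₁} {F₂ : C₂ ⥤ ElemFrobenioid Φ₂}
  (hF₁ : IsFrobenioid F₁) (hF₂ : IsFrobenioid F₂)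
  (hpf₁ : Objectwise (fun M _ => IsPerfFactorial M) Φ₁) (hpf₂ : Objectwise (fun M _ => IsPerfFactorial M) Φ₂)
  (hD₁ : IsOfFSMType D₁) (hD₂ : IsOfFSMType D₂) (Ψ : C₁ ≌ C₂)
  (histr₁ : (PreFrobenioidData.ofFunctor Φ₁ F₁).IsOfIsotropicType)
  (histr₂ : (PreFrobenioidData.ofFunctor Φ₂ F₂).IsOfIsotropicType)
  (hng₁ : ¬ (PreFrobenioidData.ofFunctor Φ₁ F₁).IsOfGroupLikeType)
  (hng₂ : ¬ (PreFrobenioidData.ofFunctor Φ₂ F₂).IsOfGroupLikeType)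
  (hR₁ : (PreFrobenioidData.ofFunctor Φ₁ F₁).IsOfRationallyStandardType (rsParams hF₁ fun a 𝔭 => PrimarySupp a 𝔭))
  (hs : (PreFrobenioidData.ofFunctor Φ₁ F₁).Cor411Setting (PreFrobenioidData.ofFunctor Φ₂ F₂) Ψ)

set_option backward.isDefEq.respectTransparency false in
/-- **F-1028 / [FrdI] Corollary 4.11 (iii), compatibility clause `Cor411iii_compat` AT THE DATA OF RECORD**
(p. 92): for Frobenioids `C_i → F_{Φ_i}` with `Φ_i` perf-factorial over base categories of FSM-type, of isotropic
and non-group-like type ("when the `C_i` are of isotropic, but not of group-like type"), `C₁` of rationally standard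
type at its Def. 4.5 (iii) parameters, and an equivalence `Ψ : C₁ ⥲ C₂` in the setting of Cor. 4.11, the typed
clause holds for THE descended `Ψ^Φ'` on `D₁` over THE `Ψ^Base` of Cor. 4.11 (ii) and THE bijections of primes
`e'` induced by THE `Ψ^Prime` of Thm. 4.2 (ii) — the fifth and sixth components of the ∃-package
`cor411iii_compat_holds_of_isOfFSMType`, named by `Exists.choose`: `Ψ^Φ'_X` maps `Φ₁(X)_𝔭` onto
`Φ₂(Ψ^Base X)_{e'_X(𝔭)}`. [cite: MochizukiFrdI2008, Cor. 4.11 (iii) p.92] -/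
theorem cor411iii_compat_inst :
    (PreFrobenioidData.ofFunctor Φ₁ F₁).Cor411iii_compat (PreFrobenioidData.ofFunctor Φ₂ F₂)
      (cor411iii_compat_holds_of_isOfFSMType hF₁ hF₂ hpf₁ hpf₂ hD₁ hD₂ Ψ histr₁ histr₂ hng₁ hng₂ hR₁
        hs).choose_spec.choose_spec.choose_spec.choose_spec.choose
      (cor411iii_compat_holds_of_isOfFSMType hF₁ hF₂ hpf₁ hpf₂ hD₁ hD₂ Ψ histr₁ histr₂ hng₁ hng₂ hR₁
        hs).choose_spec.choose_spec.choose_spec.choose_spec.choose_spec.choose :=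
  (cor411iii_compat_holds_of_isOfFSMType hF₁ hF₂ hpf₁ hpf₂ hD₁ hD₂ Ψ histr₁ histr₂ hng₁ hng₂ hR₁
    hs).choose_spec.choose_spec.choose_spec.choose_spec.choose_spec.choose_spec.2.2.2.2.2

end PreFrobenioid

end Literature.AlgebraicGeometry.Frobenioids
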